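import Summits.ValiantsHypothesis.ValiantsHypothesis.Theorems.KPlusLogSqLawTropicalBLexCensus
import Summits.ValiantsHypothesis.ValiantsHypothesis.Theorems.KPlusLogSqLawTropicalBClassReversal

/-!
# Route «KPlusLogSqLaw», crux `TropicalB` (stmt-ValiantsHypothesis-19771) — LEX-NT, part 7: the MIRROR cells (slow digits)

HONEST FRAMING.  Census corollary (seat val-sym-trop-p5 g14, 2026-08-28; cell `pub-symmetroid`, `--supports stmt-ValiantsHypothesis-19771 --as helper`)
of the lex census (`LexCore.designRowD_lex`, part 4) transported through the class-reversal duality of the unsigned row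
(`ClassReversal.designRowD_of_classRev`, val-sym-trop-p5 g12: reverse the classes, reflect the exponents, read the chain backwards).  Finite-format
statement; nothing here bears on `TropicalB` in its window, `WeakLifting`, DoorA26 / DoorA34, `MatrixDescartes` (stmt-ValiantsHypothesis-18050) or
VP ≠ VNP.

* `designRowD_lex_mirror` — `m ≥ 4`; classes `a₀ a₁ a₂ a₃` with `d a₀ < d a₁ < d a₂ < d a₃` and the MIRROR slope order
  `(m−1)·d a₂ + d a₀ < m·d a₁`, `(m−2)·d a₃ + d a₁ < (m−1)·d a₂` (gaps DEcreasing fast: `d a₁ − d a₀ ≫ d a₂ − d a₁ ≫ d a₃ − d a₂`; e.g. `(0, 20, 24, 25)`):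
  the unsigned row is `≤ multichoose K m − 2` — the histograms `a₁^m ≻ a₂^{m−1} a₀ ≻ a₃^{m−2} a₁ a₀` are never all visited.
* `designRowD_slowDigit_four` — the `K = 4` column, and the instance `(0, m²+m, m²+2m, m²+2m+1)`… kept simple: `(0, 20, 24, 25)` at `m = 4`.
So BOTH extreme corners of the order-type simplex of `(m,4)` exponents are deficient for every `m ≥ 4`; the counting-tight cells live in between.  [this cell]
-/

set_option linter.dupNamespace false
set_option autoImplicit false

namespace Summit.ValiantsHypothesis.ValiantsHypothesis.Theorems.KPlusLogSqLaw

namespace LexCore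

open Summit.ValiantsHypothesis.ValiantsHypothesis.Theorems.MatrixDescartes.Negative
open Finset

variable {m K : ℕ}

/-- **MIRROR LEX CENSUS.**  `m ≥ 4`; `d a₀ < d a₁ < d a₂ < d a₃` with `(m−1)·d a₂ + d a₀ < m·d a₁` and `(m−2)·d a₃ + d a₁ < (m−1)·d a₂`: every
design has unsigned row `≤ multichoose K m − 2`. [this cell; `designRowD_lex` + class reversal] -/
theorem designRowD_lex_mirror (hm : 4 ≤ m) (d : Fin K → ℕ) (v ε : Fin m → Fin m → Fin K → ℤ) (a₀ a₁ a₂ a₃ : Fin K)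
    (h01 : d a₀ < d a₁) (h12 : d a₁ < d a₂) (h23 : d a₂ < d a₃)
    (hBA : (m - 1 : ℤ) * d a₂ + d a₀ < (m : ℤ) * d a₁) (hCB : (m - 2 : ℤ) * d a₃ + d a₁ < (m - 1 : ℤ) * d a₂) :
    DesignRowD d v ε (Nat.multichoose K m - 2) := by
  -- reflect the exponents at a common bound `D`
  set D : ℕ := d a₃ + (univ : Finset (Fin K)).sup d with hDdef
  have hD : ∀ l, d l ≤ D := fun l => le_add_left (Finset.le_sup (Finset.mem_univ l))
  refine ClassReversal.designRowD_of_classRev d D v ε hD _ ?_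
  -- the reflected design is in the lex regime with classes `rev a₃ < rev a₂ < rev a₁ < rev a₀`
  have hD0 := hD a₀; have hD1 := hD a₁; have hD2 := hD a₂; have hD3 := hD a₃
  refine designRowD_lex hm _ _ _ (Fin.rev a₃) (Fin.rev a₂) (Fin.rev a₁) (Fin.rev a₀) ?_ ?_ ?_ ?_ ?_
  · simp only [Fin.rev_rev]; omega
  · simp only [Fin.rev_rev]; omega
  · simp only [Fin.rev_rev]; omega
  · simp only [Fin.rev_rev]; push_cast [Nat.cast_sub hD0, Nat.cast_sub hD1, Nat.cast_sub hD2]; linarith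
  · simp only [Fin.rev_rev]; push_cast [Nat.cast_sub hD0, Nat.cast_sub hD1, Nat.cast_sub hD2, Nat.cast_sub hD3]; linarith

/-- **THE `K = 4` COLUMN, SLOW DIGITS (`m ≥ 4`)**: `d 0 < d 1 < d 2 < d 3` with `(m−1)·d 2 + d 0 < m·d 1` and `(m−2)·d 3 + d 1 < (m−1)·d 2` ⇒ unsigned
row `≤ multichoose 4 m − 2 = C(m+3,3) − 2`. [this cell] -/
theorem designRowD_slowDigit_four (hm : 4 ≤ m) (d : Fin 4 → ℕ) (h01 : d 0 < d 1) (h12 : d 1 < d 2) (h23 : d 2 < d 3)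
    (hBA : (m - 1 : ℤ) * d 2 + d 0 < (m : ℤ) * d 1) (hCB : (m - 2 : ℤ) * d 3 + d 1 < (m - 1 : ℤ) * d 2)
    (v ε : Fin m → Fin m → Fin 4 → ℤ) : DesignRowD d v ε (Nat.multichoose 4 m - 2) :=
  designRowD_lex_mirror hm d v ε 0 1 2 3 h01 h12 h23 hBA hCB

/-- the slow-digit instance `(0, 20, 24, 25)` at `m = 4`: unsigned row `≤ 33`. [this cell] -/
theorem designRowD_slowDigit_four_example (v ε : Fin 4 → Fin 4 → Fin 4 → ℤ) :
    DesignRowD (![0, 20, 24, 25] : Fin 4 → ℕ) v ε 33 := by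
  have h := designRowD_slowDigit_four (m := 4) (le_refl 4) ![0, 20, 24, 25] (by decide) (by decide) (by decide) ?_ ?_ v ε
  · have e : Nat.multichoose 4 4 - 2 = 33 := by rw [multichoose_four_eq]; decide
    rw [e] at h; exact h
  · show (4 - 1 : ℤ) * ((![0, 20, 24, 25] : Fin 4 → ℕ) 2 : ℕ) + ((![0, 20, 24, 25] : Fin 4 → ℕ) 0 : ℕ) <
      (4 : ℕ) * ((![0, 20, 24, 25] : Fin 4 → ℕ) 1 : ℕ)
    decide
  · show (4 - 2 : ℤ) * ((![0, 20, 24, 25] : Fin 4 → ℕ) 3 : ℕ) + ((![0, 20, 24, 25] : Fin 4 → ℕ) 1 : ℕ) <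
      (4 - 1 : ℤ) * ((![0, 20, 24, 25] : Fin 4 → ℕ) 2 : ℕ)
    decide

end LexCore

end Summit.ValiantsHypothesis.ValiantsHypothesis.Theorems.KPlusLogSqLaw
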